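import Summits.QuantumFields.BalabanUV.Beta.GAN24.Entry112SupLogCubic
import Summits.QuantumFields.BalabanUV.T4Continuum.Support.ScalarAveragedPropagator

/-!
# Row G-an2-4 ∕ (CONV-C) — the SCALAR-CARRIER reduction engines: per-block row sums of ANY matrix on the 0-forms of Bałaban's fine
# torus ⇒ the localized and the global `ℓ^∞ → ℓ^∞` sup letters; the bodies of the scalar letters for `G′ = Gps` from per-block rows

NOT IN PRINT; OUR BOOKKEEPING.  Cell `pub-balaban`, G-an2-4 crux team (coordinator ruling e34b3e0c (2)), leaf seat
`b2b-balaban-gan24-formalise-leaf-04` (gen 47), item «S2-TRANSPORT∕END» FILE 3 (journal `CLAIMS.log` l.28813 ∕ l.28859).  The road-P2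
owner's consumer (`b2b-balaban-gan24-p2` gen 29: `GAN24/StaircaseLaplacianDefect` p253982 and the one-step sup law
`GAN24/SoftMinimiserOneStepSup.norm_Msoft_succ_sub_stair_le_of_letters`, whose four letters `B₁, B₂, C₁, C₂` are displayed hypotheses) lives on the
SCALAR carrier — 0-forms `Tor (fine n M) → ℂ`, `∂_ν = B5Action121.sdiff (fine n M) n ν`, `G′ = T4Continuum.ScalarAveragedPropagator.Gps n M a′
= (Δ + a′Π′)⁻¹` (NE2's `U = 1` scalar averaged propagator) — and binds the letters `‖G′∂_νᴴ‖_{∞→∞}` and `‖G′∂_μᴴ∂_νᴴ‖_{∞→∞}` (typed by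
`…-leaf-01` gen 54 as `ScalarEntry110GDiv ∕ ScalarSup110GDiv ∕ ScalarEntry112GDivDivLog ∕ ScalarSup112GDivDivLog d a′`, staged l.28781 ∕ l.28822).
My gen-46∕47 engines (`Entry110GradCubic.norm_mulVec_bpt_le_of_block_row_sum`, `Entry115SupCubic.norm_mulVec_le_of_block_row_sum`) are typed
on the VECTOR carrier `Tor (fine n M) × Fin (d+1)`; THIS FILE is their scalar twin plus the four scalar letter bodies FROM per-block row
bounds — pure carrier bookkeeping so that whichever seat supplies scalar per-block rows (the scalar resolvent step; not claimed here)
closes the scalar letters in three lines.  No Support leaf, no new object, no Literature fact, 0 `def`, 0 `def … : Prop`, 0 sorry.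

WHAT IS PROVED (kernel; any `d`, any `n ≥ 1`, any torus `M : Fin (d+1) → ℕ`, any matrix `K` on `Tor (fine n M)`):
 * §1 `sum_blockOf_mul_scalar` — pv15's block swap `B5G110BlockRowSum.sum_blockOf_mul` on 0-forms;
 * §2 **`norm_mulVec_bpt_le_of_block_row_sum_scalar`**: per-block row sums `Σ_{x′ : blockOf x′ = y′} ‖K(x,x′)‖ ≤ B₁·e^{−δ|blockOf x − y′|_{T₁,∞}}`
   ⟹ for `f` supported in the unit cube `B(y′)` with `|f| ≤ B` and `x ∈ B(y)`: `‖(K f)(x)‖ ≤ B₁·e^{−δ|y − y′|_{T₁,∞}}·B`;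
 * §3 **`norm_mulVec_le_of_block_row_sum_scalar`**: the same with `δ > 0` ⟹ `‖(K f)(x)‖ ≤ B₁·K_{d+1}(δ)·B` for every `x` and every `f` with
   `|f| ≤ B` (`K_{d+1} = B4Sect5Proof.latticeConst (d+1)`, volume-free; pv15's `sum_exp_torusSupNorm_sub_rep_le`);
 * §4 THE SCALAR LETTER BODIES FROM PER-BLOCK ROWS (any torus, any `a′`; the second-order pair with ANY allowance `A : ℕ → ℝ`):
   **`scalarEntry110GDiv_of_block_row_sum`** ∕ **`scalarSup110GDiv_of_block_row_sum`** (for `K = Gps·∂_νᴴ`) and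
   **`scalarEntry112GDivDiv_of_block_row_sum`** ∕ **`scalarSup112GDivDiv_of_block_row_sum`** (for `K = Gps·∂_μᴴ·∂_νᴴ`) — conclusions = the
   bodies of `…-leaf-01`'s `ScalarEntry110GDiv d a′` ∕ `ScalarSup110GDiv d a′` and, at `A n = 1 + log n`, of `ScalarEntry112GDivDivLog d a′` ∕
   `ScalarSup112GDivDivLog d a′`, symbol for symbol (that statement file is staged, not in the tree — no `example` against it here);
   the two `Sup` conclusions are the requester's letters `B₂` (`G′∂′ᴴ`) and `B₁` (`G′∂′ᴴ∂′ᴴ`, at `μ = ν`) read at `n := R·N`;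
 * §5 (v3) EXPORT **`bpt_row_sum_le_of_block_row_sum`** ∕ **`block_row_sum_le_of_bpt_row_sum`**: block form ⇄ integer-indexed (`bpt ∕ toT`)
   form of per-block row bounds for ANY matrix and ANY weight profile `w` — the shape of leaf-01's (L0) END and of the requester's
   (SCALAR-LETTERS-LOC) line (`HOME/INBOX.md` 2026-08-21T09:07Z) — plus `sum_ite_blockOf_eq_sum_bpt`, `exists_eq_bpt_blockOf`;
 * §4b the COARSE-SIDE letters: **`scalarEntry110Grad_of_block_row_sum`** ∕ **`scalarSup110Grad_of_block_row_sum`** (for `K = ∂_μ·Gps`;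
   the `Sup` conclusion is the requester's `C₁`) and **`scalarEntry112DivGrad_of_block_row_sum`** ∕ **`scalarSup112DivGrad_of_block_row_sum`**
   (for `K = ∂_μᴴ·∂_ν·Gps`, allowance `A`; the `Sup` conclusion at `μ = ν` is the requester's `C₂`) — so each of the four letters of
   `norm_Msoft_succ_sub_stair_le_of_letters` is ONE per-block row bound away, on any torus `M : Fin (d+1) → ℕ`.

HONEST SCOPE.  [folklore] bookkeeping; 0 estimates — every per-block row bound is a HYPOTHESIS, supplied by nobody yet for `Gps` (the
scalar twin of the NE3 flat chain's resolvent step and a scalar `eF`-dictionary do not exist in the tree at this file's writing).  Nothing of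
Bałaban's asserted: [B5] Prop. 1.2 (1.110) ∕ (1.112) ∕ (1.115) (`Balaban1984PropagatorsI` pp. 35–36) are printed for the VECTOR `G` — the
scalar letters are OURS, as `…-leaf-01` labels them.  NOT (CONV-C), NEVER «G-an2-4 closed», NOT NE2 ∕ NE3, NOT D1, NOT BetaPertH, NOT the
continuum limit, NOT Clay.  HONEST DEPENDENCY: continuum YM on T⁴ ⇐ BetaPertH ∧ nine spine estimates (0/9 proved); BetaPertH ⇐ (D1) ∧
(D4) ∧ CAP+tail; G-an2-4 gates asym, D1 and NE2/3/4.
-/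

noncomputable section

open scoped BigOperators ComplexConjugate Matrix
open Finset

namespace Summit.QuantumFields.BalabanUV.Beta.GAN24.ScalarSupReductions

open Literature.MathematicalPhysics.QuantumFieldTheory.Balaban1983to89
open B5Prop11Plancherel (Tor fine)
open B5Action121 (sdiff)
open B5Block118 (bpt)
open B5Blocks16 (blockOf blockOf_bpt bpt_bijective)
open B6LowerBound2153Torus (toT rep toT_rep)
open B4TorusKernel.MultiPeriod (torusSupNorm)
open B4Sect5Proof (latticeConst latticeConst_nonneg)
open B5Hk163TorusHolderRate (sum_exp_torusSupNorm_sub_rep_le)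
open Summit.QuantumFields.BalabanUV.T4Continuum.ScalarAveragedPropagator (Gps)
open Entry110GradCubic (torusSupNorm_rep_toT_sub_rep_toT)
open Entry112SupLogCubic (latticeConst_succ_pos)

variable {d : ℕ}

/-! ## §1 The block swap on 0-forms -/

/-- pv15's block swap on 0-forms: `Σ_x w(blockOf x)·F(x) = Σ_{y′} w(y′)·Σ_{x : blockOf x = y′} F(x)`. [folklore] -/
theorem sum_blockOf_mul_scalar (n : ℕ) [NeZero n] (M : Fin (d + 1) → ℕ) [∀ μ, NeZero (M μ)]
    (w : Tor M → ℝ) (F : Tor (fine n M) → ℝ) :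
    ∑ x, w (blockOf n M x) * F x = ∑ y' : Tor M, w y' * ∑ x, (if blockOf n M x = y' then F x else 0) := by
  simp_rw [Finset.mul_sum, mul_ite, mul_zero]
  rw [Finset.sum_comm]
  refine Finset.sum_congr rfl fun x _ => ?_
  rw [Finset.sum_ite_eq]
  simp

/-! ## §2 Per-block row sums ⇒ the localized sup entry (0-forms, any torus, any matrix) -/

/-- **PER-BLOCK ROW SUMS ⇒ THE LOCALIZED SUP ENTRY, SCALAR CARRIER**: if every row `x` of `K` has block row sums
`Σ_{x′ : blockOf x′ = y′} ‖K(x,x′)‖ ≤ B₁·e^{−δ·|rep(blockOf x) − rep y′|_{T₁,∞}}`, then for every `f` supported in the unit cube `B(y′)` with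
`|f| ≤ B` and every site `x = n·y + r` of `B(y)`: `‖(K f)(x)‖ ≤ B₁·e^{−δ·|y − y′|_{T₁,∞}}·B`. [folklore] -/
theorem norm_mulVec_bpt_le_of_block_row_sum_scalar (n : ℕ) [NeZero n] (M : Fin (d + 1) → ℕ) [∀ μ, NeZero (M μ)]
    (K : Matrix (Tor (fine n M)) (Tor (fine n M)) ℂ) {B₁ δ : ℝ}
    (hK : ∀ (x : Tor (fine n M)) (y' : Tor M),
      ∑ x' : Tor (fine n M), (if blockOf n M x' = y' then ‖K x x'‖ else 0)
        ≤ B₁ * Real.exp (-(δ * torusSupNorm M (rep M (blockOf n M x) - rep M y'))))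
    (y y' : Fin (d + 1) → ℤ) (f : Tor (fine n M) → ℂ) {B : ℝ} (hfB : ∀ z, ‖f z‖ ≤ B)
    (hsupp : ∀ z, f z ≠ 0 → ∃ r' : Fin (d + 1) → Fin n, z = bpt n M (toT M y') r') (r : Fin (d + 1) → Fin n) :
    ‖(K *ᵥ f) (bpt n M (toT M y) r)‖ ≤ B₁ * Real.exp (-(δ * torusSupNorm M (y - y'))) * B := by
  set x₀ : Tor (fine n M) := bpt n M (toT M y) r with hx₀
  have hB0 : 0 ≤ B := (norm_nonneg _).trans (hfB x₀)
  have hterm : ∀ z : Tor (fine n M), ‖K x₀ z * f z‖ ≤ (if blockOf n M z = toT M y' then ‖K x₀ z‖ else 0) * B := by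
    intro z
    by_cases hf : f z = 0
    · rw [hf, mul_zero, norm_zero]
      exact mul_nonneg (by split_ifs <;> simp) hB0
    · obtain ⟨r', hr'⟩ := hsupp z hf
      have hb : blockOf n M z = toT M y' := by rw [hr', blockOf_bpt]
      rw [if_pos hb, norm_mul]
      exact mul_le_mul_of_nonneg_left (hfB z) (norm_nonneg _)
  have hblk : blockOf n M x₀ = toT M y := blockOf_bpt n M (toT M y) r
  calc ‖(K *ᵥ f) x₀‖ = ‖∑ z, K x₀ z * f z‖ := by simp only [Matrix.mulVec, dotProduct]
    _ ≤ ∑ z, ‖K x₀ z * f z‖ := norm_sum_le _ _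
    _ ≤ ∑ z, (if blockOf n M z = toT M y' then ‖K x₀ z‖ else 0) * B := Finset.sum_le_sum fun z _ => hterm z
    _ = (∑ z, (if blockOf n M z = toT M y' then ‖K x₀ z‖ else 0)) * B := by rw [Finset.sum_mul]
    _ ≤ B₁ * Real.exp (-(δ * torusSupNorm M (rep M (blockOf n M x₀) - rep M (toT M y')))) * B :=
        mul_le_mul_of_nonneg_right (hK x₀ (toT M y')) hB0
    _ = B₁ * Real.exp (-(δ * torusSupNorm M (y - y'))) * B := by
        rw [hblk, torusSupNorm_rep_toT_sub_rep_toT]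

/-! ## §3 Per-block row sums with decay ⇒ a volume-uniform `ℓ^∞ → ℓ^∞` bound (0-forms, any torus, any matrix) -/

/-- **PER-BLOCK ROW SUMS WITH DECAY ⇒ GLOBAL SUP BOUND, SCALAR CARRIER**: if every row `x` has block row sums
`Σ_{x′ : blockOf x′ = y′} ‖K(x,x′)‖ ≤ B₁·e^{−δ·|rep(blockOf x) − rep y′|_{T₁,∞}}` with `δ > 0`, then for every `f` with `|f| ≤ B` and every `x`:
`‖(K f)(x)‖ ≤ B₁·K_{d+1}(δ)·B` (`K_{d+1} = latticeConst (d+1)`, independent of the volume). [folklore] -/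
theorem norm_mulVec_le_of_block_row_sum_scalar (n : ℕ) [NeZero n] (M : Fin (d + 1) → ℕ) [∀ μ, NeZero (M μ)]
    (K : Matrix (Tor (fine n M)) (Tor (fine n M)) ℂ) {B₁ δ : ℝ} (hδ : 0 < δ)
    (hK : ∀ (x : Tor (fine n M)) (y' : Tor M),
      ∑ x' : Tor (fine n M), (if blockOf n M x' = y' then ‖K x x'‖ else 0)
        ≤ B₁ * Real.exp (-(δ * torusSupNorm M (rep M (blockOf n M x) - rep M y'))))
    (f : Tor (fine n M) → ℂ) {B : ℝ} (hfB : ∀ z, ‖f z‖ ≤ B) (x : Tor (fine n M)) :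
    ‖(K *ᵥ f) x‖ ≤ B₁ * latticeConst (d + 1) δ * B := by
  have hB0 : 0 ≤ B := (norm_nonneg _).trans (hfB x)
  have hB1 : 0 ≤ B₁ := by
    have h0 : (0 : ℝ) ≤ ∑ x' : Tor (fine n M), (if blockOf n M x' = blockOf n M x then ‖K x x'‖ else 0) :=
      Finset.sum_nonneg fun x' _ => by split_ifs <;> simp
    have hpos : 0 < Real.exp (-(δ * torusSupNorm M (rep M (blockOf n M x) - rep M (blockOf n M x)))) := Real.exp_pos _
    exact (mul_nonneg_iff_of_pos_right hpos).mp (h0.trans (hK x _))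
  have hrow : ∑ z, ‖K x z‖ ≤ B₁ * latticeConst (d + 1) δ := by
    have hswap := sum_blockOf_mul_scalar n M (fun _ => (1 : ℝ)) (fun z => ‖K x z‖)
    simp only [one_mul] at hswap
    rw [hswap]
    calc ∑ y' : Tor M, ∑ z, (if blockOf n M z = y' then ‖K x z‖ else 0)
        ≤ ∑ y' : Tor M, B₁ * Real.exp (-(δ * torusSupNorm M (rep M (blockOf n M x) - rep M y'))) :=
          Finset.sum_le_sum fun y' _ => hK x y'
      _ = B₁ * ∑ y' : Tor M, Real.exp (-(δ * torusSupNorm M (rep M (blockOf n M x) - rep M y'))) := by rw [Finset.mul_sum]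
      _ ≤ B₁ * latticeConst (d + 1) δ :=
          mul_le_mul_of_nonneg_left (sum_exp_torusSupNorm_sub_rep_le M hδ (rep M (blockOf n M x))) hB1
  calc ‖(K *ᵥ f) x‖ = ‖∑ z, K x z * f z‖ := by simp only [Matrix.mulVec, dotProduct]
    _ ≤ ∑ z, ‖K x z * f z‖ := norm_sum_le _ _
    _ ≤ ∑ z, ‖K x z‖ * B := Finset.sum_le_sum fun z _ => by
        rw [norm_mul]; exact mul_le_mul_of_nonneg_left (hfB z) (norm_nonneg _)
    _ = (∑ z, ‖K x z‖) * B := by rw [Finset.sum_mul]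
    _ ≤ B₁ * latticeConst (d + 1) δ * B := mul_le_mul_of_nonneg_right hrow hB0

/-! ## §4 The scalar letter bodies for `G′ = Gps n M a′` from per-block row bounds -/

section ScalarLetters

variable (d) (a' : ℝ) (A : ℕ → ℝ)

/-- **`‖(G′∂_νᴴ f)(x)‖ ≤ C·e^{−δ₀|y−y′|_∞}·|f|` FROM PER-BLOCK ROWS OF `G′·∂_νᴴ`** (the body of `…-leaf-01`'s `ScalarEntry110GDiv d a′`; any torus).
[folklore] -/
theorem scalarEntry110GDiv_of_block_row_sum
    (h : ∃ B₂ δ : ℝ, 0 < B₂ ∧ 0 < δ ∧ ∀ (n : ℕ) (M : Fin (d + 1) → ℕ) [NeZero n] [∀ μ, NeZero (M μ)],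
      ∀ (ν : Fin (d + 1)) (x : Tor (fine n M)) (y' : Tor M),
        ∑ x' : Tor (fine n M),
            (if blockOf n M x' = y' then ‖(Gps n M a' * (sdiff (fine n M) (n : ℂ) ν)ᴴ) x x'‖ else 0)
          ≤ B₂ * Real.exp (-(δ * torusSupNorm M (rep M (blockOf n M x) - rep M y')))) :
    ∃ δ₀ C : ℝ, 0 < δ₀ ∧ 0 < C ∧
      ∀ (n : ℕ) (M : Fin (d + 1) → ℕ) [NeZero n] [∀ μ, NeZero (M μ)], 1 ≤ n →
        ∀ (ν : Fin (d + 1)) (y y' : Fin (d + 1) → ℤ) (f : Tor (fine n M) → ℂ) (B : ℝ),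
          (∀ z, ‖f z‖ ≤ B) → (∀ z, f z ≠ 0 → ∃ r' : Fin (d + 1) → Fin n, z = bpt n M (toT M y') r') →
          ∀ (r : Fin (d + 1) → Fin n),
            ‖(Gps n M a' *ᵥ ((sdiff (fine n M) (n : ℂ) ν)ᴴ *ᵥ f)) (bpt n M (toT M y) r)‖
              ≤ C * Real.exp (-(δ₀ * torusSupNorm M (y - y'))) * B := by
  obtain ⟨B₂, δ, hB, hδ, hblock⟩ := h
  refine ⟨δ, B₂, hδ, hB, ?_⟩
  intro n M _ _ _hn ν y y' f B hfB hsupp r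
  rw [Matrix.mulVec_mulVec]
  exact norm_mulVec_bpt_le_of_block_row_sum_scalar n M _ (fun x y₁ => hblock n M ν x y₁) y y' f hfB hsupp r

/-- **`‖G′∂_νᴴ‖_{ℓ^∞→ℓ^∞} ≤ C` FROM PER-BLOCK ROWS OF `G′·∂_νᴴ`** (the body of `ScalarSup110GDiv d a′`; any torus, volume-free). [folklore] -/
theorem scalarSup110GDiv_of_block_row_sum
    (h : ∃ B₂ δ : ℝ, 0 < B₂ ∧ 0 < δ ∧ ∀ (n : ℕ) (M : Fin (d + 1) → ℕ) [NeZero n] [∀ μ, NeZero (M μ)],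
      ∀ (ν : Fin (d + 1)) (x : Tor (fine n M)) (y' : Tor M),
        ∑ x' : Tor (fine n M),
            (if blockOf n M x' = y' then ‖(Gps n M a' * (sdiff (fine n M) (n : ℂ) ν)ᴴ) x x'‖ else 0)
          ≤ B₂ * Real.exp (-(δ * torusSupNorm M (rep M (blockOf n M x) - rep M y')))) :
    ∃ C : ℝ, 0 < C ∧
      ∀ (n : ℕ) (M : Fin (d + 1) → ℕ) [NeZero n] [∀ μ, NeZero (M μ)], 1 ≤ n →
        ∀ (ν : Fin (d + 1)) (f : Tor (fine n M) → ℂ) (B : ℝ), (∀ z, ‖f z‖ ≤ B) →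
          ∀ x, ‖(Gps n M a' *ᵥ ((sdiff (fine n M) (n : ℂ) ν)ᴴ *ᵥ f)) x‖ ≤ C * B := by
  obtain ⟨B₂, δ, hB, hδ, hblock⟩ := h
  refine ⟨B₂ * latticeConst (d + 1) δ, mul_pos hB (latticeConst_succ_pos hδ), ?_⟩
  intro n M _ _ _hn ν f B hfB x
  rw [Matrix.mulVec_mulVec]
  exact norm_mulVec_le_of_block_row_sum_scalar n M _ hδ (fun x' y' => hblock n M ν x' y') f hfB x

/-- **`‖(G′∂_μᴴ∂_νᴴ f)(x)‖ ≤ C·A(n)·e^{−δ₀|y−y′|_∞}·|f|` FROM PER-BLOCK ROWS OF `G′·∂_μᴴ·∂_νᴴ` WITH ALLOWANCE `A(n)`** (at `A n = 1 + log n`: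
the body of `ScalarEntry112GDivDivLog d a′`; any torus). [folklore] -/
theorem scalarEntry112GDivDiv_of_block_row_sum
    (h : ∃ B₂ δ : ℝ, 0 < B₂ ∧ 0 < δ ∧ ∀ (n : ℕ) (M : Fin (d + 1) → ℕ) [NeZero n] [∀ μ, NeZero (M μ)],
      ∀ (μ ν : Fin (d + 1)) (x : Tor (fine n M)) (y' : Tor M),
        ∑ x' : Tor (fine n M),
            (if blockOf n M x' = y' then
              ‖(Gps n M a' * (sdiff (fine n M) (n : ℂ) μ)ᴴ * (sdiff (fine n M) (n : ℂ) ν)ᴴ) x x'‖ else 0)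
          ≤ B₂ * A n * Real.exp (-(δ * torusSupNorm M (rep M (blockOf n M x) - rep M y')))) :
    ∃ δ₀ C : ℝ, 0 < δ₀ ∧ 0 < C ∧
      ∀ (n : ℕ) (M : Fin (d + 1) → ℕ) [NeZero n] [∀ μ, NeZero (M μ)], 1 ≤ n →
        ∀ (μ ν : Fin (d + 1)) (y y' : Fin (d + 1) → ℤ) (f : Tor (fine n M) → ℂ) (B : ℝ),
          (∀ z, ‖f z‖ ≤ B) → (∀ z, f z ≠ 0 → ∃ r' : Fin (d + 1) → Fin n, z = bpt n M (toT M y') r') →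
          ∀ (r : Fin (d + 1) → Fin n),
            ‖(Gps n M a' *ᵥ ((sdiff (fine n M) (n : ℂ) μ)ᴴ *ᵥ ((sdiff (fine n M) (n : ℂ) ν)ᴴ *ᵥ f))) (bpt n M (toT M y) r)‖
              ≤ C * A n * Real.exp (-(δ₀ * torusSupNorm M (y - y'))) * B := by
  obtain ⟨B₂, δ, hB, hδ, hblock⟩ := h
  refine ⟨δ, B₂, hδ, hB, ?_⟩
  intro n M _ _ _hn μ ν y y' f B hfB hsupp r
  simp only [Matrix.mulVec_mulVec, ← Matrix.mul_assoc]
  exact norm_mulVec_bpt_le_of_block_row_sum_scalar n M _ (fun x y₁ => hblock n M μ ν x y₁) y y' f hfB hsupp r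

/-- **`‖G′∂_μᴴ∂_νᴴ‖_{ℓ^∞→ℓ^∞} ≤ C·A(n)` FROM PER-BLOCK ROWS OF `G′·∂_μᴴ·∂_νᴴ` WITH ALLOWANCE `A(n)`** (at `A n = 1 + log n`: the body of
`ScalarSup112GDivDivLog d a′` = the requester's `‖G′∂′ᴴ∂′ᴴ‖_{∞→∞}` letter; any torus, volume-free). [folklore] -/
theorem scalarSup112GDivDiv_of_block_row_sum
    (h : ∃ B₂ δ : ℝ, 0 < B₂ ∧ 0 < δ ∧ ∀ (n : ℕ) (M : Fin (d + 1) → ℕ) [NeZero n] [∀ μ, NeZero (M μ)],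
      ∀ (μ ν : Fin (d + 1)) (x : Tor (fine n M)) (y' : Tor M),
        ∑ x' : Tor (fine n M),
            (if blockOf n M x' = y' then
              ‖(Gps n M a' * (sdiff (fine n M) (n : ℂ) μ)ᴴ * (sdiff (fine n M) (n : ℂ) ν)ᴴ) x x'‖ else 0)
          ≤ B₂ * A n * Real.exp (-(δ * torusSupNorm M (rep M (blockOf n M x) - rep M y')))) :
    ∃ C : ℝ, 0 < C ∧
      ∀ (n : ℕ) (M : Fin (d + 1) → ℕ) [NeZero n] [∀ μ, NeZero (M μ)], 1 ≤ n →
        ∀ (μ ν : Fin (d + 1)) (f : Tor (fine n M) → ℂ) (B : ℝ), (∀ z, ‖f z‖ ≤ B) →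
          ∀ x, ‖(Gps n M a' *ᵥ ((sdiff (fine n M) (n : ℂ) μ)ᴴ *ᵥ ((sdiff (fine n M) (n : ℂ) ν)ᴴ *ᵥ f))) x‖
              ≤ C * A n * B := by
  obtain ⟨B₂, δ, hB, hδ, hblock⟩ := h
  refine ⟨B₂ * latticeConst (d + 1) δ, mul_pos hB (latticeConst_succ_pos hδ), ?_⟩
  intro n M _ _ _hn μ ν f B hfB x
  simp only [Matrix.mulVec_mulVec, ← Matrix.mul_assoc]
  have h := norm_mulVec_le_of_block_row_sum_scalar n M _ hδ (fun x' y' => hblock n M μ ν x' y') f hfB x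
  calc _ ≤ B₂ * A n * latticeConst (d + 1) δ * B := h
    _ = B₂ * latticeConst (d + 1) δ * A n * B := by ring

/-! ### §4b The coarse-side letters `∂_μG′` and `∂_μᴴ∂_νG′` (the requester's `C₁`, `C₂` in `GAN24/SoftMinimiserOneStepSup`) -/

/-- **`‖(∂_μG′ f)(x)‖ ≤ C·e^{−δ₀|y−y′|_∞}·|f|` FROM PER-BLOCK ROWS OF `∂_μ·G′`** (localized; any torus; the scalar twin of (E2)). [folklore] -/
theorem scalarEntry110Grad_of_block_row_sum
    (h : ∃ B₁ δ : ℝ, 0 < B₁ ∧ 0 < δ ∧ ∀ (n : ℕ) (M : Fin (d + 1) → ℕ) [NeZero n] [∀ μ, NeZero (M μ)],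
      ∀ (μ : Fin (d + 1)) (x : Tor (fine n M)) (y' : Tor M),
        ∑ x' : Tor (fine n M),
            (if blockOf n M x' = y' then ‖(sdiff (fine n M) (n : ℂ) μ * Gps n M a') x x'‖ else 0)
          ≤ B₁ * Real.exp (-(δ * torusSupNorm M (rep M (blockOf n M x) - rep M y')))) :
    ∃ δ₀ C : ℝ, 0 < δ₀ ∧ 0 < C ∧
      ∀ (n : ℕ) (M : Fin (d + 1) → ℕ) [NeZero n] [∀ μ, NeZero (M μ)], 1 ≤ n →
        ∀ (μ : Fin (d + 1)) (y y' : Fin (d + 1) → ℤ) (f : Tor (fine n M) → ℂ) (B : ℝ),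
          (∀ z, ‖f z‖ ≤ B) → (∀ z, f z ≠ 0 → ∃ r' : Fin (d + 1) → Fin n, z = bpt n M (toT M y') r') →
          ∀ (r : Fin (d + 1) → Fin n),
            ‖(sdiff (fine n M) (n : ℂ) μ *ᵥ (Gps n M a' *ᵥ f)) (bpt n M (toT M y) r)‖
              ≤ C * Real.exp (-(δ₀ * torusSupNorm M (y - y'))) * B := by
  obtain ⟨B₁, δ, hB, hδ, hblock⟩ := h
  refine ⟨δ, B₁, hδ, hB, ?_⟩
  intro n M _ _ _hn μ y y' f B hfB hsupp r
  rw [Matrix.mulVec_mulVec]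
  exact norm_mulVec_bpt_le_of_block_row_sum_scalar n M _ (fun x y₁ => hblock n M μ x y₁) y y' f hfB hsupp r

/-- **`‖∂_μG′‖_{ℓ^∞→ℓ^∞} ≤ C` FROM PER-BLOCK ROWS OF `∂_μ·G′`** (global, volume-free; = the shape of the requester's letter `C₁`
`‖(∂_μ (G′ f))(z)‖ ≤ C₁·b` for `|f| ≤ b`, `GAN24/SoftMinimiserOneStepSup.norm_Msoft_succ_sub_stair_le_of_letters`). [folklore] -/
theorem scalarSup110Grad_of_block_row_sum
    (h : ∃ B₁ δ : ℝ, 0 < B₁ ∧ 0 < δ ∧ ∀ (n : ℕ) (M : Fin (d + 1) → ℕ) [NeZero n] [∀ μ, NeZero (M μ)],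
      ∀ (μ : Fin (d + 1)) (x : Tor (fine n M)) (y' : Tor M),
        ∑ x' : Tor (fine n M),
            (if blockOf n M x' = y' then ‖(sdiff (fine n M) (n : ℂ) μ * Gps n M a') x x'‖ else 0)
          ≤ B₁ * Real.exp (-(δ * torusSupNorm M (rep M (blockOf n M x) - rep M y')))) :
    ∃ C : ℝ, 0 < C ∧
      ∀ (n : ℕ) (M : Fin (d + 1) → ℕ) [NeZero n] [∀ μ, NeZero (M μ)], 1 ≤ n →
        ∀ (μ : Fin (d + 1)) (f : Tor (fine n M) → ℂ) (B : ℝ), (∀ z, ‖f z‖ ≤ B) →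
          ∀ x, ‖(sdiff (fine n M) (n : ℂ) μ *ᵥ (Gps n M a' *ᵥ f)) x‖ ≤ C * B := by
  obtain ⟨B₁, δ, hB, hδ, hblock⟩ := h
  refine ⟨B₁ * latticeConst (d + 1) δ, mul_pos hB (latticeConst_succ_pos hδ), ?_⟩
  intro n M _ _ _hn μ f B hfB x
  rw [Matrix.mulVec_mulVec]
  exact norm_mulVec_le_of_block_row_sum_scalar n M _ hδ (fun x' y' => hblock n M μ x' y') f hfB x

/-- **`‖(∂_μᴴ∂_νG′ f)(x)‖ ≤ C·A(n)·e^{−δ₀|y−y′|_∞}·|f|` FROM PER-BLOCK ROWS OF `∂_μᴴ·∂_ν·G′` WITH ALLOWANCE `A(n)`** (localized; any torus; the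
pure second differences of `G′`). [folklore] -/
theorem scalarEntry112DivGrad_of_block_row_sum
    (h : ∃ B₂ δ : ℝ, 0 < B₂ ∧ 0 < δ ∧ ∀ (n : ℕ) (M : Fin (d + 1) → ℕ) [NeZero n] [∀ μ, NeZero (M μ)],
      ∀ (μ ν : Fin (d + 1)) (x : Tor (fine n M)) (y' : Tor M),
        ∑ x' : Tor (fine n M),
            (if blockOf n M x' = y' then
              ‖((sdiff (fine n M) (n : ℂ) μ)ᴴ * sdiff (fine n M) (n : ℂ) ν * Gps n M a') x x'‖ else 0)
          ≤ B₂ * A n * Real.exp (-(δ * torusSupNorm M (rep M (blockOf n M x) - rep M y')))) :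
    ∃ δ₀ C : ℝ, 0 < δ₀ ∧ 0 < C ∧
      ∀ (n : ℕ) (M : Fin (d + 1) → ℕ) [NeZero n] [∀ μ, NeZero (M μ)], 1 ≤ n →
        ∀ (μ ν : Fin (d + 1)) (y y' : Fin (d + 1) → ℤ) (f : Tor (fine n M) → ℂ) (B : ℝ),
          (∀ z, ‖f z‖ ≤ B) → (∀ z, f z ≠ 0 → ∃ r' : Fin (d + 1) → Fin n, z = bpt n M (toT M y') r') →
          ∀ (r : Fin (d + 1) → Fin n),
            ‖((sdiff (fine n M) (n : ℂ) μ)ᴴ *ᵥ (sdiff (fine n M) (n : ℂ) ν *ᵥ (Gps n M a' *ᵥ f))) (bpt n M (toT M y) r)‖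
              ≤ C * A n * Real.exp (-(δ₀ * torusSupNorm M (y - y'))) * B := by
  obtain ⟨B₂, δ, hB, hδ, hblock⟩ := h
  refine ⟨δ, B₂, hδ, hB, ?_⟩
  intro n M _ _ _hn μ ν y y' f B hfB hsupp r
  simp only [Matrix.mulVec_mulVec, ← Matrix.mul_assoc]
  exact norm_mulVec_bpt_le_of_block_row_sum_scalar n M _ (fun x y₁ => hblock n M μ ν x y₁) y y' f hfB hsupp r

/-- **`‖∂_μᴴ∂_νG′‖_{ℓ^∞→ℓ^∞} ≤ C·A(n)` FROM PER-BLOCK ROWS OF `∂_μᴴ·∂_ν·G′` WITH ALLOWANCE `A(n)`** (global, volume-free; at `μ = ν` = the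
shape of the requester's letter `C₂` `‖(∂_μᴴ∂_μ(G′ f))(z)‖ ≤ C₂·b`). [folklore] -/
theorem scalarSup112DivGrad_of_block_row_sum
    (h : ∃ B₂ δ : ℝ, 0 < B₂ ∧ 0 < δ ∧ ∀ (n : ℕ) (M : Fin (d + 1) → ℕ) [NeZero n] [∀ μ, NeZero (M μ)],
      ∀ (μ ν : Fin (d + 1)) (x : Tor (fine n M)) (y' : Tor M),
        ∑ x' : Tor (fine n M),
            (if blockOf n M x' = y' then
              ‖((sdiff (fine n M) (n : ℂ) μ)ᴴ * sdiff (fine n M) (n : ℂ) ν * Gps n M a') x x'‖ else 0)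
          ≤ B₂ * A n * Real.exp (-(δ * torusSupNorm M (rep M (blockOf n M x) - rep M y')))) :
    ∃ C : ℝ, 0 < C ∧
      ∀ (n : ℕ) (M : Fin (d + 1) → ℕ) [NeZero n] [∀ μ, NeZero (M μ)], 1 ≤ n →
        ∀ (μ ν : Fin (d + 1)) (f : Tor (fine n M) → ℂ) (B : ℝ), (∀ z, ‖f z‖ ≤ B) →
          ∀ x, ‖((sdiff (fine n M) (n : ℂ) μ)ᴴ *ᵥ (sdiff (fine n M) (n : ℂ) ν *ᵥ (Gps n M a' *ᵥ f))) x‖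
              ≤ C * A n * B := by
  obtain ⟨B₂, δ, hB, hδ, hblock⟩ := h
  refine ⟨B₂ * latticeConst (d + 1) δ, mul_pos hB (latticeConst_succ_pos hδ), ?_⟩
  intro n M _ _ _hn μ ν f B hfB x
  simp only [Matrix.mulVec_mulVec, ← Matrix.mul_assoc]
  have h := norm_mulVec_le_of_block_row_sum_scalar n M _ hδ (fun x' y' => hblock n M μ ν x' y') f hfB x
  calc _ ≤ B₂ * A n * latticeConst (d + 1) δ * B := h
    _ = B₂ * latticeConst (d + 1) δ * A n * B := by ring

end ScalarLetters

/-! ## §5 EXPORT: block form ⇄ integer-indexed form of per-block row bounds (any matrix on the 0-forms, any torus)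

The (α) chain (`ScalarFlatResolvent.scalar_block_rows`) and §2∕§3 above speak the BLOCK form
`Σ_{x′ : blockOf x′ = y′} ‖K x x′‖ ≤ w(|rep(blockOf x) − rep y′|_{T₁,∞})`; leaf-01's (L0) END `gps_block_row_sum_le` and the requester's
«INTERFACE REQUEST G-an2-4: (SCALAR-LETTERS-LOC)» (`HOME/INBOX.md` 2026-08-21T09:07Z; consumer `MinimiserOneStepDecay.rowDecay_of_bpt_row_sum`)
speak the INTEGER-INDEXED form `Σ_{r′} ‖K (n·x̄ + r) (n·x̄′ + r′)‖ ≤ w(|x − x′|_{T₁,∞})` (`x̄ = toT M x`).  The two are equivalent, for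
every weight profile `w : ℝ → ℝ` (so `B·e^{−δ·t}` and `B·(1 + log n)·e^{−δ·t}` at once). -/

section Export

/-- the block fibre sum as a sum over in-block offsets: `Σ_{x′ : blockOf x′ = y′} f x′ = Σ_{r′} f (n·ȳ′ + r′)` (pv15's `bpt_bijective`,
`blockOf_bpt`). [folklore] -/
theorem sum_ite_blockOf_eq_sum_bpt (n : ℕ) [NeZero n] (M : Fin (d + 1) → ℕ) [∀ μ, NeZero (M μ)]
    (f : Tor (fine n M) → ℝ) (y' : Tor M) :
    ∑ x', (if blockOf n M x' = y' then f x' else 0) = ∑ r' : Fin (d + 1) → Fin n, f (bpt n M y' r') := by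
  rw [← (bpt_bijective n M).sum_comp (fun x' => if blockOf n M x' = y' then f x' else 0), Fintype.sum_prod_type]
  simp only [blockOf_bpt]
  rw [Finset.sum_eq_single y' (fun y _ hy => by simp [hy]) (fun h => absurd (Finset.mem_univ y') h)]
  simp

/-- every fine site is `n·(blockOf x) + r` for some offset `r`. [folklore] -/
theorem exists_eq_bpt_blockOf (n : ℕ) [NeZero n] (M : Fin (d + 1) → ℕ) [∀ μ, NeZero (M μ)] (x : Tor (fine n M)) :
    ∃ r : Fin (d + 1) → Fin n, x = bpt n M (blockOf n M x) r := by
  set e := Equiv.ofBijective _ (bpt_bijective n M) with he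
  refine ⟨(e.symm x).2, ?_⟩
  have h : e (e.symm x) = x := e.apply_symm_apply x
  conv_lhs => rw [← h]
  rfl

/-- **BLOCK FORM ⇒ INTEGER-INDEXED FORM** (any matrix `K` on the 0-forms, any torus, any weight profile `w`): per-block rows
`Σ_{x′ : blockOf x′ = y′} ‖K x x′‖ ≤ w(|rep(blockOf x) − rep y′|_{T₁,∞})` give, for all integer labels `x x′` and offsets `r`,
`Σ_{r′} ‖K (n·x̄ + r) (n·x̄′ + r′)‖ ≤ w(|x − x′|_{T₁,∞})` — the (SCALAR-LETTERS-LOC) ∕ (L0) shape (`Entry110GradCubic.torusSupNorm_rep_toT_sub_rep_toT`).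
[folklore] -/
theorem bpt_row_sum_le_of_block_row_sum (n : ℕ) [NeZero n] (M : Fin (d + 1) → ℕ) [∀ μ, NeZero (M μ)]
    (K : Matrix (Tor (fine n M)) (Tor (fine n M)) ℂ) (w : ℝ → ℝ)
    (hK : ∀ (x : Tor (fine n M)) (y' : Tor M),
      ∑ x', (if blockOf n M x' = y' then ‖K x x'‖ else 0) ≤ w (torusSupNorm M (rep M (blockOf n M x) - rep M y')))
    (x x' : Fin (d + 1) → ℤ) (r : Fin (d + 1) → Fin n) :
    ∑ r' : Fin (d + 1) → Fin n, ‖K (bpt n M (toT M x) r) (bpt n M (toT M x') r')‖ ≤ w (torusSupNorm M (x - x')) := by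
  have h := hK (bpt n M (toT M x) r) (toT M x')
  rwa [sum_ite_blockOf_eq_sum_bpt, blockOf_bpt, torusSupNorm_rep_toT_sub_rep_toT] at h

/-- **INTEGER-INDEXED FORM ⇒ BLOCK FORM** (the converse; lets §2∕§3 eat leaf-01's (L0) ROW shape and the (SCALAR-LETTERS-LOC) rows
directly): `∀ x x′ r, Σ_{r′} ‖K (n·x̄ + r) (n·x̄′ + r′)‖ ≤ w(|x − x′|_{T₁,∞})` gives the per-block rows of every fine row `z` against every
block `y′`, `≤ w(|rep(blockOf z) − rep y′|_{T₁,∞})` (`toT_rep`, `exists_eq_bpt_blockOf`). [folklore] -/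
theorem block_row_sum_le_of_bpt_row_sum (n : ℕ) [NeZero n] (M : Fin (d + 1) → ℕ) [∀ μ, NeZero (M μ)]
    (K : Matrix (Tor (fine n M)) (Tor (fine n M)) ℂ) (w : ℝ → ℝ)
    (hK : ∀ (x x' : Fin (d + 1) → ℤ) (r : Fin (d + 1) → Fin n),
      ∑ r' : Fin (d + 1) → Fin n, ‖K (bpt n M (toT M x) r) (bpt n M (toT M x') r')‖ ≤ w (torusSupNorm M (x - x')))
    (z : Tor (fine n M)) (y' : Tor M) :
    ∑ x', (if blockOf n M x' = y' then ‖K z x'‖ else 0) ≤ w (torusSupNorm M (rep M (blockOf n M z) - rep M y')) := by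
  obtain ⟨r, hr⟩ := exists_eq_bpt_blockOf n M z
  have h := hK (rep M (blockOf n M z)) (rep M y') r
  rw [toT_rep, toT_rep, ← hr] at h
  rwa [sum_ite_blockOf_eq_sum_bpt]

end Export

end Summit.QuantumFields.BalabanUV.Beta.GAN24.ScalarSupReductions

end
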